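import Literature.IUT.LogThetaLattice.HolomorphicHullDetM
import Literature.IUT.LogThetaLattice.GlobalFrobenioidModelsPerfectionRigidity
import HarnessLib

/-!
# [IUTchIII] Remark 3.9.5 (vii) (Ob3-3)/(Ob4) and (ix) (⊼lc) AT THE MODEL: the arithmetic degree of the global
# `det^{⊗M}` object, and "may be compared" as a degree inequality along morphisms of `(†𝓕⊛_𝔪𝔬𝔡)`
# (abc-iut cell, layer L6, zone [IUTchIII] §3; typer-of-record lineage abc-iut-L6-t4; PROOF-ONLY companion of
# `HolomorphicHullDetM.lean` — no definition, nothing assumed)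

S. Mochizuki, *Inter-universal Teichmüller theory III*, kurims manuscript (May 2020), §3, Remark 3.9.5 (vii)
pp. 131–134 and (ix) pp. 141–142 [claim: Mochizuki2012, status: disputed], read on the page (cell render
`paper:url-4b091feeb646` p0131–p0134, p0141–p0142):
* (Ob3-3) p. 132 l. 40 – p. 133 l. 8: "the arithmetic degree of such an arithmetic line bundle [`det^{⊗M}(−)` of a
  hull] may be interpreted, by working with suitable normalization factors, as the log-volume of the original
  arithmetic vector bundle";
* (Ob4) p. 133 l. 9–21: "applying the operation `det^{⊗M}(−)` yields objects that may indeed be compared to the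
  objects in the local and global Frobenioids that appear in the codomain … determined by the arithmetic line
  bundle that gives rise to the `M`-th tensor power of the `q`-pilot object";
* (ix) (⊼lc_1)/(⊼lc_2) p. 141 l. 34–44: the "`⊼`-category" of objects "equipped with a 'structure poly-morphism' to …
  `det^{⊗M}(φ(P_B))` … given by the `Aut(det^{⊗M}(φ(P_B)))`-orbit of a linear morphism" and compatible morphisms.

WHAT THE TREE HAD (consumed BY NAME, nothing re-declared). abc-iut-L6-t4 g6's statements-first typing
`HolomorphicHullDetM.lean` (p445358): `HullDetM.exponents / detExponents / logDegree / globalExponents / frakObj`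
(`det^{⊗M}(λ·𝒪_L)` at the divisor level and as an object of the INTEGRAL model `(†𝓕⊛_𝔪𝔬𝔡)` of a number field `F`
via `Prop37.ofExponents`, p417322) and `UpperCat.Obj / Obj.polyHom / Hom` (the `⊼`-category over any category);
abc-iut-w4-d005's realification on objects `Prop37.realifyObj` with the morphism-level transfer
`Prop37.isHom_realifyObj_iff` (`GlobalLGPFrobenioidsRealification.lean`); abc-iut-w4-d015's `ofFinDivisorFrak`,
`realifyExponents`, `frakDeg_ofFinDivisorFrak` (`ThetaPilotObjectsFrakModel.lean`); abc-iut-L6-d3's degree /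
log-volume model `frakDeg`, `globalLogVolume_frakRegion`, **`frakDeg_mul_le_of_isHom`** (degrees increase along
morphisms of `𝓕⊛_𝔪𝔬𝔡`, by the product formula; `GlobalFrobenioidModelsLogVolume.lean`); abc-iut-L6-t6's category
`FrakCat` / `Prop37.Ffrak F` and `FrakCat.deg_eq_one_of_isIso`; campaign-S `hullSet_subset_iff`,
`boxLogVolume_hullSet`, Dupuy–Hilado `FinDivisor.deg` / `logNorm`.

RESULTS (sorry-free):
* §1 **(Ob3-3), global form.** `HullDetM.realifyObj_frakObj`: the realification of the global object
  `det^{⊗M}(λ·𝒪_L) = Π_j 𝔭_{pl j}^{m_j e_j}` IS the real family of the divisor `Σ_j m_j e_j·[pl j]`;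
  **`HullDetM.frakDeg_realifyObj_frakObj`**: its arithmetic degree is `−Σ_j m_j·e_j(λ)·log N(pl j)`, equal to its
  global log-volume (`globalLogVolume_frakRegion_frakObj`, Prop. 3.9 (iii) at the model) and — under the residue
  dictionary `q_{K_j} = N(pl j)` of the attachment of summands to places — to the LOCAL log-degree
  `HullDetM.logDegree` (`frakDeg_realifyObj_frakObj_eq_logDegree`), hence to `M·μ^{log}_w(λ·𝒪_L)` for weights
  `m_j = M·w_j` (`frakDeg_realifyObj_frakObj_eq_mul_boxLogVolume`).
* §2 **(Ob2)/(Ob3) functoriality.** An inclusion of hulls `λ·𝒪_L ⊆ λ'·𝒪_L` gives, for nonnegative integer weights,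
  `e_j(λ') ≤ e_j(λ)` (`exponents_anti`) and the LINEAR morphism `(1, 1) : det^{⊗M}(λ·𝒪_L) → det^{⊗M}(λ'·𝒪_L)` of
  `(†𝓕⊛_𝔪𝔬𝔡)` (`isHom_one_one_frakObj_of_hullSet_subset`); so `deg det^{⊗M}` is monotone in the hull
  (`frakDeg_realifyObj_frakObj_mono`).
* §3 **(Ob4) + (⊼lc_1) as a degree inequality.** Along ANY morphism `(n, f) : P → D` of `(†𝓕⊛_𝔪𝔬𝔡)`,
  `n·deg P ≤ deg D` after realification (`Prop37.frakDeg_realifyObj_mul_le_of_hom`; linear ⇒ `deg P ≤ deg D`);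
  every member of a structure poly-morphism has the Frobenius degree of its representative
  (`UpperCat.deg_eq_of_mem_polyHom`), and a `⊼`-object under `D` with LINEAR structure poly-morphism has
  `deg ≤ deg D` (`UpperCat.frakDeg_le_of_linear`); at `D := det^{⊗M}(λ·𝒪_L)`:
  **`HullDetM.frakDeg_le_of_upperObj_linear`** `deg P ≤ −Σ_j m_j e_j log N(pl j)` (`= M·μ^{log}_w(λ·𝒪_L)` under the
  dictionary, `frakDeg_le_mul_boxLogVolume_of_upperObj_linear`).

HONEST SCOPE.  This is the kernel SHAPE in which §3's `det^{⊗M}` / `⊼`-apparatus hands a degree INEQUALITY to a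
consumer: IF the comparison of (Ob4) is realised by a [linear] morphism of the model global Frobenioid, THEN the
degrees compare.  Whether the `q`-pilot object admits such a morphism to `det^{⊗M}(φ(P_B))` is the content of
[IUTchIII] Cor. 3.12, Step (xi), on which nothing here bears; no side is taken; typed ≠ proved; a junction at the
model is not the disputed comparison itself.  Proof-only: no definition, no instance, no notation.
-/

noncomputable section

open MeasureTheory Set Metric CategoryTheory
open scoped ENNReal NNReal
open Literature.NumberTheory.GaloisRepresentations.Ultrametric

namespace Literature.IUT.LogThetaLattice

/-! ### §1 (Ob3-3), global form: the arithmetic degree of the realified `det^{⊗M}` object -/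

namespace HullDetM

open NumberField IsDedekindDomain Literature.IUT.LogVolume GlobalFrobenioidModels

section Global

variable {J : Type*} [Fintype J] (K : J → Type*) [∀ j, NontriviallyNormedField (K j)]
  {ϖ : ∀ j, (K j)ˣ} (hϖ : ∀ j, IsUniformizer (ϖ j))
  (F : Type) [Field F] [NumberField F] (pl : J → HeightOneSpectrum (𝓞 F))

omit [NumberField F] in
/-- The realified global exponent family of `det^{⊗M}(λ·𝒪_L)` is the finite-place divisor `Σ_j m_j e_j(λ)·[pl j]`
([IUTchIII] Rmk. 3.9.5 (vii) (Ob3) p. 131, "by allowing `v_ℚ ∈ 𝕍_ℚ`, `v ∈ 𝕍` to vary] global Frobenioids"; [FrdI]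
Prop. 5.3 realification `ℤ ↦ ℝ` on divisor monoids). [claim: Mochizuki2012, status: disputed] -/
theorem realifyExponents_globalExponents (m : J → ℤ) (c : Π j, (K j)ˣ) :
    realifyExponents (globalExponents K hϖ F pl m c) =
      ∑ j, FinDivisor.of (pl j) (detExponents K hϖ m c j : ℝ) := by
  unfold globalExponents
  rw [map_sum]
  exact Finset.sum_congr rfl fun j _ => realifyExponents_single _ _

/-- `deĝ_F(Σ_j m_j e_j·[pl j]) = Σ_j m_j e_j · log N(pl j)`. [claim: Mochizuki2012, status: disputed] -/
theorem deg_realifyExponents_globalExponents (m : J → ℤ) (c : Π j, (K j)ˣ) :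
    FinDivisor.deg F (realifyExponents (globalExponents K hϖ F pl m c)) =
      ∑ j, (detExponents K hϖ m c j : ℝ) * logNorm F (pl j) := by
  rw [realifyExponents_globalExponents, FinDivisor.deg_sum_of]

/-- **The realification of `det^{⊗M}(λ·𝒪_L)`** (Prop. 3.7 (ii) `(†𝓕⊛_𝔪𝔬𝔡)_α → (†𝓕⊛ℝ_𝔪𝔬𝔡)_α` on objects, abc-iut-w4-d005's
`realifyObj`) is abc-iut-w4-d015's real family of the divisor `Σ_j m_j e_j·[pl j]`.
[claim: Mochizuki2012, status: disputed] -/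
theorem realifyObj_frakObj (m : J → ℤ) (c : Π j, (K j)ˣ) :
    Prop37.realifyObj F (frakObj K hϖ F pl m c) =
      ofFinDivisorFrak (realifyExponents (globalExponents K hϖ F pl m c)) :=
  Prop37.realifyObj_ofExponents F _

/-- **(Ob3-3), global form: the arithmetic degree of `det^{⊗M}(λ·𝒪_L)`** ([IUTchIII] Rmk. 3.9.5 (vii) p. 132–133; [FrdI]
Thm. 6.4 (i) degree on the realification, abc-iut-L6-d3's `frakDeg`): `deg det^{⊗M}(λ·𝒪_L) = −Σ_j m_j·e_j(λ)·log N(pl j)`.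
[claim: Mochizuki2012, status: disputed] -/
theorem frakDeg_realifyObj_frakObj (m : J → ℤ) (c : Π j, (K j)ˣ) :
    frakDeg (Prop37.realifyObj F (frakObj K hϖ F pl m c)) =
      -∑ j, (detExponents K hϖ m c j : ℝ) * logNorm F (pl j) := by
  rw [realifyObj_frakObj, frakDeg_ofFinDivisorFrak, deg_realifyExponents_globalExponents]

/-- **[IUTchIII] Prop. 3.9 (iii) for `det^{⊗M}(λ·𝒪_L)`**: the global log-volume of its region equals its arithmetic
degree `−Σ_j m_j e_j log N(pl j)` (abc-iut-L6-d3's `globalLogVolume_frakRegion`). [claim: Mochizuki2012, status: disputed] -/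
theorem globalLogVolume_frakRegion_frakObj (m : J → ℤ) (c : Π j, (K j)ˣ) :
    globalLogVolume (divisorLogVolume F) (frakRegion (Prop37.realifyObj F (frakObj K hϖ F pl m c))) =
      -∑ j, (detExponents K hϖ m c j : ℝ) * logNorm F (pl j) := by
  rw [globalLogVolume_frakRegion, frakDeg_realifyObj_frakObj]

end Global

section GlobalLocal

variable {J : Type*} [Fintype J] (K : J → Type*) [∀ j, NontriviallyNormedField (K j)]
  [∀ j, IsUltrametricDist (K j)] {ϖ : ∀ j, (K j)ˣ} (hϖ : ∀ j, IsUniformizer (ϖ j))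
  (F : Type) [Field F] [NumberField F] (pl : J → HeightOneSpectrum (𝓞 F))

/-- **(Ob3-3): GLOBAL degree = LOCAL log-degree** under the residue dictionary of the attachment `j ↦ pl j` of the
summands to places (`q_{K_j} = N(pl j)`, the case of print: `K_j` = the completion `F_{pl j}`):
`deg det^{⊗M}(λ·𝒪_L) = deg^{log}(det^{⊗M}(λ·𝒪_L)) = −Σ_j m_j e_j log q_j` (g6's `HullDetM.logDegree`).
[claim: Mochizuki2012, status: disputed] -/
theorem frakDeg_realifyObj_frakObj_eq_logDegree (hq : ∀ j, residueCard (K j) = Ideal.absNorm (pl j).asIdeal)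
    (m : J → ℤ) (c : Π j, (K j)ˣ) :
    frakDeg (Prop37.realifyObj F (frakObj K hϖ F pl m c)) = logDegree K hϖ m c := by
  rw [frakDeg_realifyObj_frakObj, logDegree_eq_sum_detExponents]
  congr 1
  refine Finset.sum_congr rfl fun j _ => ?_
  rw [logNorm, ← hq j]

end GlobalLocal

section Volume

variable {J : Type*} [Fintype J] (K : J → Type*) [∀ j, NontriviallyNormedField (K j)]
  [∀ j, IsUltrametricDist (K j)] [∀ j, ProperSpace (K j)] [∀ j, MeasurableSpace (K j)]
  [∀ j, BorelSpace (K j)] {ϖ : ∀ j, (K j)ˣ} (hϖ : ∀ j, IsUniformizer (ϖ j))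
  (F : Type) [Field F] [NumberField F] (pl : J → HeightOneSpectrum (𝓞 F))

/-- **(Ob3-3) in full, at the model**: with integer weights `m_j = M·w_j` and the residue dictionary, the arithmetic
degree of the GLOBAL object `det^{⊗M}(λ·𝒪_L)` of `(†𝓕⊛_𝔪𝔬𝔡)` is `M` times the Rmk. 3.1.1 (iii) weighted log-volume of the
hull `λ·𝒪_L` — "the arithmetic degree … may be interpreted, by working with suitable normalization factors, as the
log-volume of the original arithmetic vector bundle". [claim: Mochizuki2012, status: disputed] -/
theorem frakDeg_realifyObj_frakObj_eq_mul_boxLogVolume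
    (hq : ∀ j, residueCard (K j) = Ideal.absNorm (pl j).asIdeal) (m : J → ℤ) (w : J → ℝ) (M : ℝ)
    (hm : ∀ j, (m j : ℝ) = M * w j) (c : Π j, (K j)ˣ) :
    frakDeg (Prop37.realifyObj F (frakObj K hϖ F pl m c)) =
      M * boxLogVolume K w (hullSet K (fun j => (c j : K j))) := by
  rw [frakDeg_realifyObj_frakObj_eq_logDegree K hϖ F pl hq, logDegree_eq_mul_boxLogVolume K hϖ m w M hm]

end Volume

/-! ### §2 (Ob2)/(Ob3) functoriality: inclusions of hulls are linear morphisms of `(†𝓕⊛_𝔪𝔬𝔡)` -/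

section Functoriality

variable {J : Type*} (K : J → Type*) [∀ j, NontriviallyNormedField (K j)]
  {ϖ : ∀ j, (K j)ˣ} (hϖ : ∀ j, IsUniformizer (ϖ j))

/-- Inclusion of hulls REVERSES exponents: `λ·𝒪_L ⊆ λ'·𝒪_L` iff `‖λ_j‖ ≤ ‖λ'_j‖` for all `j` (campaign-S
`hullSet_subset_iff`), i.e. `ord(λ'_j) ≤ ord(λ_j)` (`‖ϖ_j‖ < 1`). [claim: Mochizuki2012, status: disputed] -/
theorem exponents_anti {c d : Π j, (K j)ˣ}
    (h : hullSet K (fun j => (c j : K j)) ⊆ hullSet K (fun j => (d j : K j))) (j : J) :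
    exponents K hϖ d j ≤ exponents K hϖ c j := by
  have hj : ‖(c j : K j)‖ ≤ ‖(d j : K j)‖ := (hullSet_subset_iff K).mp h j
  rw [(hϖ j).norm_eq_zpow_ordFun (c j), (hϖ j).norm_eq_zpow_ordFun (d j),
    zpow_le_zpow_iff_right_of_lt_one₀ (norm_pos_iff.mpr (ϖ j).ne_zero) (hϖ j).1] at hj
  exact hj

/-- With NONNEGATIVE integer weights the `det^{⊗M}` exponent vector is likewise reversed along inclusions of hulls.
[claim: Mochizuki2012, status: disputed] -/
theorem detExponents_anti {m : J → ℤ} (hm : ∀ j, 0 ≤ m j) {c d : Π j, (K j)ˣ}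
    (h : hullSet K (fun j => (c j : K j)) ⊆ hullSet K (fun j => (d j : K j))) (j : J) :
    detExponents K hϖ m d j ≤ detExponents K hϖ m c j :=
  mul_le_mul_of_nonneg_left (exponents_anti K hϖ h j) (hm j)

variable [Fintype J] (F : Type) [Field F] [NumberField F] (pl : J → HeightOneSpectrum (𝓞 F))

omit [NumberField F] in
/-- Pointwise comparison of the global exponent families along an inclusion of hulls (nonnegative weights):
`Σ_{pl j = v} m_j e_j(λ') ≤ Σ_{pl j = v} m_j e_j(λ)` at every finite place `v`. [claim: Mochizuki2012, status: disputed] -/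
theorem globalExponents_apply_anti {m : J → ℤ} (hm : ∀ j, 0 ≤ m j) {c d : Π j, (K j)ˣ}
    (h : hullSet K (fun j => (c j : K j)) ⊆ hullSet K (fun j => (d j : K j))) (v : HeightOneSpectrum (𝓞 F)) :
    globalExponents K hϖ F pl m d v ≤ globalExponents K hϖ F pl m c v := by
  classical
  unfold globalExponents
  rw [Finsupp.finsetSum_apply, Finsupp.finsetSum_apply]
  refine Finset.sum_le_sum fun j _ => ?_
  rw [Finsupp.single_apply, Finsupp.single_apply]
  split_ifs with hj
  · exact detExponents_anti K hϖ hm h j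
  · exact le_rfl

/-- **Inclusions of hulls are LINEAR morphisms of `(†𝓕⊛_𝔪𝔬𝔡)`** ([IUTchIII] Rmk. 3.9.5 (vii) (Ob2)/(Ob3): hulls "define
… arithmetic vector bundles", `det^{⊗M}` of which "yield objects in the … global Frobenioids"; Ex. 3.6 (ii): an
elementary morphism is an `f` with `f·𝔍_{1,v} ⊆ 𝔍_{2,v}`): for nonnegative weights and `λ·𝒪_L ⊆ λ'·𝒪_L`, the pair
`(n, f) = (1, 1)` is a morphism `det^{⊗M}(λ·𝒪_L) → det^{⊗M}(λ'·𝒪_L)` (`𝔭^{N} ⊆ 𝔭^{N'}` iff `N' ≤ N`).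
[claim: Mochizuki2012, status: disputed] -/
theorem isHom_one_one_frakObj_of_hullSet_subset {m : J → ℤ} (hm : ∀ j, 0 ≤ m j) {c d : Π j, (K j)ˣ}
    (h : hullSet K (fun j => (c j : K j)) ⊆ hullSet K (fun j => (d j : K j))) :
    FrakObj.IsHom (nonneg := Prop37.nonneg F) (β := Prop37.beta F)
      (frakObj K hϖ F pl m c) (frakObj K hϖ F pl m d) 1 1 := by
  rw [Prop37.isHom_iff]
  rintro (w | w)
  · rw [Prop37.mem_nonneg_inl]
    simp only [ofMul_one, map_zero, PNat.one_coe, Nat.cast_one, one_zsmul, zero_add, frakObj,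
      Prop37.ofExponents_cls_inl, sub_zero, le_refl]
  · rw [Prop37.mem_nonneg_inr]
    simp only [ofMul_one, map_zero, PNat.one_coe, Nat.cast_one, one_zsmul, zero_add, frakObj,
      Prop37.ofExponents_cls_inr, sub_nonneg]
    exact globalExponents_apply_anti K hϖ F pl hm h _

/-- **`deg det^{⊗M}` is monotone in the hull** (nonnegative weights): `λ·𝒪_L ⊆ λ'·𝒪_L` ⇒
`deg det^{⊗M}(λ·𝒪_L) ≤ deg det^{⊗M}(λ'·𝒪_L)` — obtained THROUGH the Frobenioid: the linear morphism of
`isHom_one_one_frakObj_of_hullSet_subset`, realified (abc-iut-w4-d005 `isHom_realifyObj_iff`), increases degrees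
(abc-iut-L6-d3 `frakDeg_mul_le_of_isHom`). [claim: Mochizuki2012, status: disputed] -/
theorem frakDeg_realifyObj_frakObj_mono {m : J → ℤ} (hm : ∀ j, 0 ≤ m j) {c d : Π j, (K j)ˣ}
    (h : hullSet K (fun j => (c j : K j)) ⊆ hullSet K (fun j => (d j : K j))) :
    frakDeg (Prop37.realifyObj F (frakObj K hϖ F pl m c)) ≤ frakDeg (Prop37.realifyObj F (frakObj K hϖ F pl m d)) := by
  have hhom := (Prop37.isHom_realifyObj_iff F (frakObj K hϖ F pl m c) (frakObj K hϖ F pl m d) 1 1).mpr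
    (isHom_one_one_frakObj_of_hullSet_subset K hϖ F pl hm h)
  have hle := frakDeg_mul_le_of_isHom hhom
  simpa using hle

end Functoriality

end HullDetM

/-! ### §3 (Ob4) + (⊼lc_1): morphisms of `(†𝓕⊛_𝔪𝔬𝔡)` and `⊼`-structures give degree inequalities -/

namespace Prop37

open NumberField GlobalFrobenioidModels

variable (F : Type) [Field F] [NumberField F]

/-- **"May be compared" as an inequality** ([IUTchIII] Rmk. 3.9.5 (vii) (Ob4) p. 133; Ex. 3.6 (ii) p. 108): along ANY
morphism `(n, f) : P → D` of the integral model `(†𝓕⊛_𝔪𝔬𝔡)_α` the arithmetic degrees of the realifications satisfy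
`n · deg P ≤ deg D` (the integrality `f·P_v^{n} ⊆ D_v` read in `ℝ`, abc-iut-w4-d005's `isHom_realifyObj_iff`, and the
product formula, abc-iut-L6-d3's `frakDeg_mul_le_of_isHom`). [claim: Mochizuki2012, status: disputed] -/
theorem frakDeg_realifyObj_mul_le_of_hom {X Y : Ffrak F} (φ : X ⟶ Y) :
    ((FrakCat.deg φ : ℕ) : ℝ) * frakDeg (realifyObj F X.obj) ≤ frakDeg (realifyObj F Y.obj) :=
  frakDeg_mul_le_of_isHom ((isHom_realifyObj_iff F X.obj Y.obj _ _).mpr (FrakCat.Hom.isHom φ))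

/-- Along a LINEAR morphism (`n = 1`, the "linear morphism[s]" of [FrdI] Def. 1.2 (i) named in (⊼lc_1)):
`deg P ≤ deg D`. [claim: Mochizuki2012, status: disputed] -/
theorem frakDeg_realifyObj_le_of_linear {X Y : Ffrak F} (φ : X ⟶ Y) (hφ : FrakCat.deg φ = 1) :
    frakDeg (realifyObj F X.obj) ≤ frakDeg (realifyObj F Y.obj) := by
  have h := frakDeg_realifyObj_mul_le_of_hom F φ
  rwa [hφ, PNat.one_coe, Nat.cast_one, one_mul] at h

/-- The OBSTRUCTION form (contrapositive): if `deg D < n · deg P` then `(†𝓕⊛_𝔪𝔬𝔡)_α` has NO morphism `P → D` of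
Frobenius degree `n`; in particular `deg D < deg P` excludes every linear morphism `P → D` — a comparison in the
sense of (Ob4) can only run from the smaller degree to the larger. [claim: Mochizuki2012, status: disputed] -/
theorem deg_ne_of_frakDeg_lt {X Y : Ffrak F} (n : ℕ+)
    (h : frakDeg (realifyObj F Y.obj) < ((n : ℕ) : ℝ) * frakDeg (realifyObj F X.obj)) (φ : X ⟶ Y) :
    FrakCat.deg φ ≠ n := by
  intro hφ
  have hle := frakDeg_realifyObj_mul_le_of_hom F φ
  rw [hφ] at hle
  exact absurd hle (not_le.mpr h)

/-- No LINEAR morphism `P → D` exists once `deg D < deg P`. [claim: Mochizuki2012, status: disputed] -/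
theorem deg_ne_one_of_frakDeg_lt {X Y : Ffrak F}
    (h : frakDeg (realifyObj F Y.obj) < frakDeg (realifyObj F X.obj)) (φ : X ⟶ Y) : FrakCat.deg φ ≠ 1 :=
  deg_ne_of_frakDeg_lt F 1 (by rwa [PNat.one_coe, Nat.cast_one, one_mul]) φ

end Prop37

namespace UpperCat

open NumberField GlobalFrobenioidModels Prop37

variable (F : Type) [Field F] [NumberField F] (D : Ffrak F)

/-- Every member of the structure poly-morphism of a `⊼`-object of `(†𝓕⊛_𝔪𝔬𝔡)_α` has the Frobenius degree of its
representative (automorphisms have Frobenius degree `1`, abc-iut-L6-t6's `FrakCat.deg_eq_one_of_isIso`): being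
"given by the `Aut(D)`-orbit of a LINEAR morphism" ((⊼lc_1) p. 141) is a property of the `⊼`-object, not of the
representative. [claim: Mochizuki2012, status: disputed] -/
theorem deg_eq_of_mem_polyHom (A : Obj D) {g : A.obj ⟶ D} (hg : g ∈ A.polyHom) :
    FrakCat.deg g = FrakCat.deg A.hom := by
  obtain ⟨α, rfl⟩ := hg
  rw [FrakCat.deg_comp, FrakCat.deg_eq_one_of_isIso α.hom, one_mul]

/-- **A `⊼`-object under `D` compares to `D` in degree**: `n · deg A ≤ deg D`, `n` the Frobenius degree of the
structure poly-morphism ((⊼lc_1) p. 141 with (Ob4) p. 133, at the model). [claim: Mochizuki2012, status: disputed] -/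
theorem frakDeg_mul_le (A : Obj D) :
    ((FrakCat.deg A.hom : ℕ) : ℝ) * frakDeg (realifyObj F A.obj.obj) ≤ frakDeg (realifyObj F D.obj) :=
  frakDeg_realifyObj_mul_le_of_hom F A.hom

/-- **A `⊼`-object under `D` with LINEAR structure poly-morphism has `deg ≤ deg D`** ((⊼lc_1): "the `Aut(D)`-orbit of
a linear morphism … to `det^{⊗M}(φ(P_B))`"). [claim: Mochizuki2012, status: disputed] -/
theorem frakDeg_le_of_linear (A : Obj D) (hA : FrakCat.deg A.hom = 1) :
    frakDeg (realifyObj F A.obj.obj) ≤ frakDeg (realifyObj F D.obj) :=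
  frakDeg_realifyObj_le_of_linear F A.hom hA

/-- `⊼`-morphisms ((⊼lc_2) p. 141, "compatible with the structure poly-morphism") compare degrees of their ends in
the same way: `n · deg A ≤ deg B` for `u : A → B` of Frobenius degree `n`. [claim: Mochizuki2012, status: disputed] -/
theorem Hom.frakDeg_mul_le {A B : Obj D} (u : Hom D A B) :
    ((FrakCat.deg u.1 : ℕ) : ℝ) * frakDeg (realifyObj F A.obj.obj) ≤ frakDeg (realifyObj F B.obj.obj) :=
  frakDeg_realifyObj_mul_le_of_hom F u.1

end UpperCat

/-! ### §3 bis: at `D := det^{⊗M}(λ·𝒪_L)` -/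

namespace HullDetM

open NumberField IsDedekindDomain Literature.IUT.LogVolume GlobalFrobenioidModels

section UnderDetM

variable {J : Type*} [Fintype J] (K : J → Type*) [∀ j, NontriviallyNormedField (K j)]
  {ϖ : ∀ j, (K j)ˣ} (hϖ : ∀ j, IsUniformizer (ϖ j))
  (F : Type) [Field F] [NumberField F] (pl : J → HeightOneSpectrum (𝓞 F))

/-- **(Ob4) + (⊼lc_1) ⇒ the degree inequality, at the model.** If an object `P` of `(†𝓕⊛_𝔪𝔬𝔡)_α` carries a `⊼`-structure
under `det^{⊗M}(λ·𝒪_L)` whose structure poly-morphism is LINEAR — i.e. some `f ∈ F^×` with `f·P_v ⊆ det^{⊗M}(λ·𝒪_L)_v`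
at every place — then `deg P ≤ deg det^{⊗M}(λ·𝒪_L) = −Σ_j m_j e_j(λ) log N(pl j)`.  This is the form in which the
`det^{⊗M}` / `⊼`-apparatus of Rmk. 3.9.5 (vii)(ix) can deliver an inequality of degrees; whether a given object (e.g. the
one arising from the `q`-pilot object) admits such a structure is NOT addressed here. [claim: Mochizuki2012, status: disputed] -/
theorem frakDeg_le_of_upperObj_linear (m : J → ℤ) (c : Π j, (K j)ˣ)
    (A : UpperCat.Obj (FrakCat.of (frakObj K hϖ F pl m c) : Prop37.Ffrak F)) (hA : FrakCat.deg A.hom = 1) :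
    frakDeg (Prop37.realifyObj F A.obj.obj) ≤ -∑ j, (detExponents K hϖ m c j : ℝ) * logNorm F (pl j) := by
  have h := UpperCat.frakDeg_le_of_linear F _ A hA
  rwa [FrakCat.obj_of, frakDeg_realifyObj_frakObj] at h

/-- The same for a structure poly-morphism of any Frobenius degree `n`: `n · deg P ≤ deg det^{⊗M}(λ·𝒪_L)`.
[claim: Mochizuki2012, status: disputed] -/
theorem frakDeg_mul_le_of_upperObj (m : J → ℤ) (c : Π j, (K j)ˣ)
    (A : UpperCat.Obj (FrakCat.of (frakObj K hϖ F pl m c) : Prop37.Ffrak F)) :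
    ((FrakCat.deg A.hom : ℕ) : ℝ) * frakDeg (Prop37.realifyObj F A.obj.obj) ≤
      -∑ j, (detExponents K hϖ m c j : ℝ) * logNorm F (pl j) := by
  have h := UpperCat.frakDeg_mul_le F _ A
  rwa [FrakCat.obj_of, frakDeg_realifyObj_frakObj] at h

end UnderDetM

section UnderDetMVolume

variable {J : Type*} [Fintype J] (K : J → Type*) [∀ j, NontriviallyNormedField (K j)]
  [∀ j, IsUltrametricDist (K j)] [∀ j, ProperSpace (K j)] [∀ j, MeasurableSpace (K j)]
  [∀ j, BorelSpace (K j)] {ϖ : ∀ j, (K j)ˣ} (hϖ : ∀ j, IsUniformizer (ϖ j))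
  (F : Type) [Field F] [NumberField F] (pl : J → HeightOneSpectrum (𝓞 F))

/-- **… in log-volume currency**: under the residue dictionary and weights `m_j = M·w_j`, a `⊼`-object `P` under
`det^{⊗M}(λ·𝒪_L)` with linear structure poly-morphism has `deg P ≤ M · μ^{log}_w(λ·𝒪_L)` ((Ob3-3) + (Ob4) + (⊼lc_1) at the
model; the right-hand side is `M` times campaign-S's weighted hull log-volume of [IUTchIII] Rmk. 3.1.1 (iii) /
Rmk. 3.9.5 (i)). [claim: Mochizuki2012, status: disputed] -/
theorem frakDeg_le_mul_boxLogVolume_of_upperObj_linear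
    (hq : ∀ j, residueCard (K j) = Ideal.absNorm (pl j).asIdeal) (m : J → ℤ) (w : J → ℝ) (M : ℝ)
    (hm : ∀ j, (m j : ℝ) = M * w j) (c : Π j, (K j)ˣ)
    (A : UpperCat.Obj (FrakCat.of (frakObj K hϖ F pl m c) : Prop37.Ffrak F)) (hA : FrakCat.deg A.hom = 1) :
    frakDeg (Prop37.realifyObj F A.obj.obj) ≤ M * boxLogVolume K w (hullSet K (fun j => (c j : K j))) := by
  have h := UpperCat.frakDeg_le_of_linear F _ A hA
  rwa [FrakCat.obj_of, frakDeg_realifyObj_frakObj_eq_mul_boxLogVolume K hϖ F pl hq m w M hm] at h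

end UnderDetMVolume

end HullDetM

end Literature.IUT.LogThetaLattice
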